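/-
Copyright (c) 2026. All rights reserved.
Released under Apache 2.0 license as described in the file LICENSE.
-/
import Literature.AlgebraicGeometry.ComplexMultiplication.ShimuraCyclotomicCMType
import Literature.AlgebraicGeometry.Pohlmann1968.CMTypeRankCharactersNumberField
import Literature.AlgebraicGeometry.Pohlmann1968.NondegenerateCMTypeHodgeConjecture
import Literature.AlgebraicGeometry.ComplexMultiplication.CMAbelianVarietyRealisedHolds
import Literature.NumberTheory.LFunctions.BernoulliOneOdd
import HarnessLib

/-!
# Kubota's theorem: the CM type `(ℚ(ζ_p); {ζ ↦ ζ^i : 1 ≤ i ≤ (p−1)/2})` is NONDEGENERATE (every odd prime `p`),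
# hence the Hodge conjecture for all powers of its abelian varieties

Layer `Literature/AlgebraicGeometry/ComplexMultiplication`; sequel of `ShimuraCyclotomicCMType` (Shimura 1998 §8.4
Example (1): the CM type `cmType p L hp2` of `L = ℚ(ζ_p)` cut out by the exponents `{1, …, n}`, `p = 2n + 1`, PROVED
PRIMITIVE there; its docstring lists "NOT TYPED HERE: … nondegeneracy of `S₁` (Gordon 9.4.2, not asserted by
Shimura)") and of `NumberTheory/ComplexMultiplication/CMTypeRankCharacters` (Kubota's Lemma 2 proved; "NOT here: …
Leopoldt's Lemma 3 of Kubota (non-vanishing of `Σ_{a=1}^{m} ψ(a)` from the class number formula), hence the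
nondegeneracy of the hyperelliptic Fermat quotients").  THEOREMS ONLY (no definition, no named fact, no `sorry`).

## The print

T. Kubota, *On the field extension by complex multiplication*, Trans. Amer. Math. Soc. **118** (1965) 113–122
[Kubota1965] (held text `paper:doi-10-1090-s0002-9947-1965-0190144-8`), §4, p. 120–121:

> "LEMMA 3 (H. W. Leopoldt). Let `p = 2m + 1` be an odd prime number, and let `ψ` be a character of the group of
> nonzero residue classes of `Z/(p)` such that `ψ(−1) = −1`.  Then, `Σ_{a=1}^{m} ψ(a) ≠ 0`.
> Proof. Consider the sum `Θ = Σ_{a=1}^{2m} ψ(a)a`.  Then we have always `Θ ≠ 0`, because `Θ` is a factor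
> contained in the class number formula for the `p`th cyclotomic field. … `(1 − 2ψ(2))Θ = pψ(2)B`.  This shows
> `B ≠ 0`, which proves the lemma.
> Denote by `J` the Jacobian variety of a complete, nonsingular model of the curve `y² = 1 − x^p`, `p = 2m + 1`
> being an odd prime number.  Let `ζ` be a primitive `p`th root of unity, and let `σ₁, ⋯, σ_m` be automorphisms
> of `F = Q(ζ)` determined by `ζ^{σᵢ} = ζ^i` (`i = 1, ⋯, m`).  Then, the abelian variety `J` belongs to the
> primitive CM-type `(F; {σᵢ})`, (see [5]), and it follows immediately from Lemma 2 and Lemma 3 that `(F; {σᵢ})`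
> is nondegenerate.  Thus we have the following
> THEOREM 2. Let `p` be an odd prime number.  Then, the Jacobian variety of a complete, nonsingular model of the
> curve `y² = 1 − x^p` is nondegenerate."

B. B. Gordon, *A survey of the Hodge conjecture for abelian varieties* [Gordon1999HodgeAVSurvey] (held text
`paper:arxiv-alg-geom_9709030`, p0025 L67–78), 9.4.2 (Examples [B.92] = Ribet 1980): "let `p ≥ 5` be a prime, let
`K = ℚ(ζ_p)` … identify `G = Gal(K/ℚ) ≃ (ℤ/pℤ)^×` … the set `S_a = {g ∈ G : ⟨g⟩ + ⟨ag⟩ < p}` is a simple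
CM-type.  It is nondegenerate when `a = 1`" (`S₁ = {g : 2⟨g⟩ < p} = {1, …, (p−1)/2}`).  With Hazama's theorem /
White's observation (Gordon Thm. 6.4 and §9.3: nondegenerate ⟹ `Hdg(Aᵏ) = Div(Aᵏ)` for all `k`, in the tree
`Pohlmann1968.IsNondegenerate.hodgeClassSpan_pow_eq_divisorClassesSpan` / `.hodgeConjectureFor_pow`) this is the
Hodge conjecture for every power of every abelian variety of this CM type, unconditionally.

## What is proved (following Kubota's §4: Lemma 2 is the tree's character formula, Lemma 3 is §1, Theorem 2 is §2–§4)

* §1 `two_adic_split_of_odd`, **`sum_filter_val_le_ne_zero_of_odd`**, **`sum_halfResidues_ne_zero_of_odd`** —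
  LEOPOLDT'S LEMMA (Kubota Lemma 3): for an odd Dirichlet character `χ` modulo the prime `p = 2n + 1`,
  `Σ_{1 ≤ a ≤ n} χ(a) ≠ 0`.  The analytic input "`Θ ≠ 0`" (`Θ = Σ_a χ(a)a = p·B_{1,χ}`) IS the tree's theorem
  `NumberTheory.LFunctions.BernoulliOneOdd.sum_mul_val_ne_zero` (from `L(1, χ̄) ≠ 0`); the rest is Kubota's
  substitution `a ↦ 2a`: `⟨2c⟩ = 2⟨c⟩ − p·[⟨c⟩ > n]` and `Σ_c χ(c) = 0` give `Θ = χ(2)(2Θ + pB)`, i.e.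
  `(1 − 2χ(2))Θ = pχ(2)B`, and `|χ(2)| = 1 ≠ 1/2`.
* §2 `isCMTypeWith_units`, **`typeRank_units_eq`** — KUBOTA'S THEOREM 2 at the level of the group
  `G = (ℤ/p)ˣ` acting on itself (`ρ = −1`, type `{u : 1 ≤ ⟨u⟩ ≤ n}`): `rank = n + 1`, by the tree's
  `IsCMTypeWith.typeRank_eq_iff_forall_oddCharacters` (Kubota's Lemma 2 = Gordon 9.4.1, PROVED in
  `CMTypeRankCharacters`) and §1 (a character `χ : Ĝ` becomes the Dirichlet character `MulChar.ofUnitHom`).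
* §3 `cmTypeRank_cmType_eq_typeRank_units`, **`isNondegenerate_cmType`** — THEOREM 2 for the CM type
  `(ℚ(ζ_p); {φᵢ : ζ ↦ ζ^i, 1 ≤ i ≤ (p−1)/2})` of the tree (`ShimuraCyclotomicCMType.cmType p L hp2`, any
  `IsCyclotomicExtension {p} ℚ L`): the exponent map `σ ↦ e(σ)` (`Pohlmann1968.Cyclotomic.expOf`) is a bijection
  `Hom(L, ℂ) ≃ (ℤ/p)ˣ` carrying the `Aut(ℂ)`-translates of the type to the `(ℤ/p)ˣ`-translates of `{1, …, n}`
  (`expOf_comp`, `exists_autExp_eq`; transport `Pohlmann1968.typeRank_eq_of_equiv`), so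
  `cmTypeRank = n + 1 = [L:ℚ]/2 + 1`.
* §4 **`hodgeClassSpan_pow_eq_divisorClassesSpan`**, **`hodgeConjectureFor_pow`**, `hodgeConjectureFor`,
  `exists_isSimple_hodgeConjectureFor_pow` — for EVERY realisation `(A, ι, θ)` of this type read on `H¹` (such `A`
  exist, Shimura §6.2 Thm. 3 = tree `exists_isCMTypeRealisation`; Kubota's `J(y² = 1 − x^p)` is one) and all
  `k, m`: `Bᵐ(Aᵏ) ⊗ ℂ = Dᵐ(Aᵏ) ⊗ ℂ` and the Hodge conjecture holds for `Aᵏ = ⨁_{Fin k} A` (a simple abelian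
  variety of dimension `(p−1)/2`, `isSimple_of_isCMTypeRealisation`), UNCONDITIONALLY.

The tree's cyclotomic CENSUS files certify ranks for `φ(N) ≤ 16` only; Yanai's prime-degree theorem covers
`ℚ(ζ_p)` only when `(p−1)/2` is prime; this file covers the type `{1, …, (p−1)/2}` for every odd prime `p`.

## References

* [Kubota1965] T. Kubota, Trans. AMS 118 (1965), §4 Lemma 2, Lemma 3 (Leopoldt), Theorem 2 (pp. 119–121).
* [Gordon1999HodgeAVSurvey] B. B. Gordon, *A survey of the Hodge conjecture for abelian varieties*, 9.4.1, 9.4.2,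
  Thm. 6.4, §9.3.
* [Shimura1998] G. Shimura, *Abelian Varieties with Complex Multiplication and Modular Functions*, §8.4 Example (1),
  §6.2 Thm. 3.
* [Lang1990] S. Lang, *Cyclotomic Fields I and II*, Ch. 2 §1 (`B_{1,χ} ≠ 0` for odd `χ`).

## Provenance

Cell `pub-hodgecm2` (COR-CM), literature seat `lit-deligne-3` gen 12 (claim KUBOTA-THM2, count-neutral own lane).
-/

noncomputable section

open NumberField

namespace Literature.AlgebraicGeometry.ComplexMultiplication

open Literature.NumberTheory.ComplexMultiplication
open Literature.AlgebraicGeometry.Motives (CMType)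
open Literature.AlgebraicGeometry.Pohlmann1968 Literature.AlgebraicGeometry.Pohlmann1968.Cyclotomic

namespace ShimuraCyclotomicCMType

/-! ## §1 Leopoldt's lemma (Kubota 1965, §4 Lemma 3): `Σ_{1 ≤ a ≤ n} χ(a) ≠ 0` for odd `χ` mod `p = 2n + 1` -/

section Leopoldt

variable {p n : ℕ} [hp : Fact p.Prime]

/-- For `p = 2n + 1` prime (with an `n`), `2 < p`. [folklore] -/
private theorem two_lt_of_eq (hpn : p = 2 * n + 1) : 2 < p := by
  have h2 := hp.out.two_le
  rcases Nat.lt_or_ge 2 p with h | h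
  · exact h
  · exfalso
    have : p = 2 := le_antisymm h h2
    omega

/-- `⟨2⟩ = 2` in `ℤ/p` for `p > 2`. [folklore] -/
private theorem val_two (h2p : 2 < p) : (2 : ZMod p).val = 2 := by
  have h : ((2 : ℕ) : ZMod p) = 2 := by norm_cast
  rw [← h, ZMod.val_natCast_of_lt h2p]

/-- **Kubota's `2`-adic split of the least residue**: `⟨2c⟩ = 2⟨c⟩` if `⟨c⟩ ≤ n` and `⟨2c⟩ = 2⟨c⟩ − p`
otherwise (`p = 2n + 1`). [cite: Kubota1965, §4 Lemma 3 (proof)] -/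
theorem natCast_val_two_mul (hpn : p = 2 * n + 1) (c : ZMod p) :
    (((2 * c).val : ℕ) : ℂ) = 2 * (c.val : ℂ) - if c.val ≤ n then (0 : ℂ) else (p : ℂ) := by
  have h2p := two_lt_of_eq hpn
  rw [ZMod.val_mul, val_two h2p]
  have hc := ZMod.val_lt c
  split_ifs with h
  · rw [Nat.mod_eq_of_lt (by omega)]
    push_cast
    ring
  · rw [Nat.mod_eq_sub_mod (by omega), Nat.mod_eq_of_lt (by omega), Nat.cast_sub (by omega)]
    push_cast
    ring

/-- **Kubota's identity `(1 − 2ψ(2))Θ = pψ(2)B`** for an odd Dirichlet character `χ` modulo the prime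
`p = 2n + 1`, with `Θ = Σ_a χ(a)⟨a⟩` and `B = Σ_{⟨a⟩ ≤ n} χ(a)` (the term `a = 0` vanishes): substitute `a ↦ 2a`
in `Θ` and use `Σ_a χ(a) = 0`. [cite: Kubota1965, §4 Lemma 3 (proof, (3)–(4))] -/
theorem two_adic_split_of_odd (hpn : p = 2 * n + 1) {χ : DirichletCharacter ℂ p} (hχ : χ.Odd) :
    (1 - 2 * χ 2) * ∑ a : ZMod p, χ a * (a.val : ℂ) =
      (p : ℂ) * χ 2 * ∑ a ∈ Finset.univ.filter (fun a : ZMod p => a.val ≤ n), χ a := by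
  classical
  have h2p := two_lt_of_eq hpn
  have hχ1 : χ ≠ 1 := NumberTheory.LFunctions.BernoulliOneOdd.ne_one_of_odd hχ
  have h2ne : (2 : ZMod p) ≠ 0 := by
    intro h
    have := congrArg ZMod.val h
    rw [val_two h2p, ZMod.val_zero] at this
    exact two_ne_zero this
  set Θ := ∑ a : ZMod p, χ a * (a.val : ℂ) with hΘ
  set B := ∑ a ∈ Finset.univ.filter (fun a : ZMod p => a.val ≤ n), χ a with hB
  -- `B` as a sum over all residues
  have hB' : B = ∑ a : ZMod p, if a.val ≤ n then χ a else 0 := by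
    rw [hB, Finset.sum_filter]
  -- the correction term: `Σ_c χ(c)·p·[⟨c⟩ > n] = p(Σ_c χ(c) − B) = −pB`
  have hcorr : ∑ c : ZMod p, χ c * (if c.val ≤ n then (0 : ℂ) else (p : ℂ)) = -(p : ℂ) * B := by
    have hpt : ∀ c : ZMod p, χ c * (if c.val ≤ n then (0 : ℂ) else (p : ℂ)) =
        (p : ℂ) * χ c - (p : ℂ) * (if c.val ≤ n then χ c else 0) := by
      intro c
      split_ifs <;> ring
    rw [Finset.sum_congr rfl fun c _ => hpt c, Finset.sum_sub_distrib, ← Finset.mul_sum, ← Finset.mul_sum,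
      MulChar.sum_eq_zero_of_ne_one hχ1, ← hB']
    ring
  -- substitution `a ↦ 2a`
  have hsub : Θ = ∑ c : ZMod p, χ (2 * c) * (((2 * c).val : ℕ) : ℂ) :=
    (Fintype.sum_bijective (fun c : ZMod p => 2 * c) (mulLeft_bijective₀ (2 : ZMod p) h2ne)
      (fun c => χ (2 * c) * (((2 * c).val : ℕ) : ℂ)) (fun a => χ a * (a.val : ℂ)) fun _ => rfl).symm
  have hmain : Θ = χ 2 * (2 * Θ + (p : ℂ) * B) := by
    calc Θ = ∑ c : ZMod p, χ (2 * c) * (((2 * c).val : ℕ) : ℂ) := hsub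
      _ = ∑ c : ZMod p, (χ 2 * (2 * (χ c * (c.val : ℂ))) -
            χ 2 * (χ c * (if c.val ≤ n then (0 : ℂ) else (p : ℂ)))) :=
          Finset.sum_congr rfl fun c _ => by rw [map_mul, natCast_val_two_mul hpn]; ring
      _ = χ 2 * (2 * Θ) - χ 2 * (-(p : ℂ) * B) := by
          rw [Finset.sum_sub_distrib, ← Finset.mul_sum, ← Finset.mul_sum, ← Finset.mul_sum, hcorr]
      _ = χ 2 * (2 * Θ + (p : ℂ) * B) := by ring
  linear_combination hmain

/-- **Leopoldt's lemma (Kubota 1965, Lemma 3)**, filter form: for an odd Dirichlet character `χ` modulo the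
prime `p = 2n + 1`, `Σ_{⟨a⟩ ≤ n} χ(a) ≠ 0` — "Then, `Σ_{a=1}^{m} ψ(a) ≠ 0`": `Θ = Σ_a χ(a)⟨a⟩ ≠ 0` (the tree's
`BernoulliOneOdd.sum_mul_val_ne_zero`, i.e. `B_{1,χ} ≠ 0`, "a factor contained in the class number formula")
and `(1 − 2χ(2))Θ = pχ(2)B` with `|χ(2)| = 1`. [cite: Kubota1965, §4 Lemma 3] -/
theorem sum_filter_val_le_ne_zero_of_odd (hpn : p = 2 * n + 1) {χ : DirichletCharacter ℂ p} (hχ : χ.Odd) :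
    ∑ a ∈ Finset.univ.filter (fun a : ZMod p => a.val ≤ n), χ a ≠ 0 := by
  classical
  intro hB
  have h2p := two_lt_of_eq hpn
  have h := two_adic_split_of_odd hpn hχ
  rw [hB, mul_zero] at h
  rcases mul_eq_zero.1 h with h1 | h2
  · -- `1 = 2χ(2)` contradicts `|χ(2)| = 1`
    have h2ne : (2 : ZMod p) ≠ 0 := by
      intro h0
      have := congrArg ZMod.val h0
      rw [val_two h2p, ZMod.val_zero] at this
      exact two_ne_zero this
    have hnorm : ‖χ 2‖ = 1 := by
      rw [show (2 : ZMod p) = ((Units.mk0 (2 : ZMod p) h2ne : (ZMod p)ˣ) : ZMod p) from rfl]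
      exact χ.unit_norm_eq_one _
    have h3 : (1 : ℂ) = 2 * χ 2 := by linear_combination h1
    have h4 := congrArg (fun z : ℂ => ‖z‖) h3
    simp only [norm_one, norm_mul, hnorm, mul_one] at h4
    norm_num at h4
  · exact NumberTheory.LFunctions.BernoulliOneOdd.sum_mul_val_ne_zero hχ h2

/-- **Leopoldt's lemma (Kubota 1965, Lemma 3)** on Shimura's residue set `{1, …, n}` (`halfResidues p n`): for
an odd Dirichlet character `χ` modulo the prime `p = 2n + 1`, `Σ_{a ∈ {1,…,n}} χ(a) ≠ 0`.
[cite: Kubota1965, §4 Lemma 3] -/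
theorem sum_halfResidues_ne_zero_of_odd (hpn : p = 2 * n + 1) {χ : DirichletCharacter ℂ p} (hχ : χ.Odd) :
    ∑ a ∈ halfResidues p n, χ a ≠ 0 := by
  classical
  haveI : NeZero p := ⟨hp.out.ne_zero⟩
  have hnp : n < p := by omega
  have h0 : (0 : ZMod p) ∉ halfResidues p n := by
    rw [mem_halfResidues_iff hnp, ZMod.val_zero]
    omega
  have hfilter : Finset.univ.filter (fun a : ZMod p => a.val ≤ n) = insert 0 (halfResidues p n) := by
    ext a
    rw [Finset.mem_filter, Finset.mem_insert, mem_halfResidues_iff hnp]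
    simp only [Finset.mem_univ, true_and]
    constructor
    · intro h
      by_cases ha : a = 0
      · exact Or.inl ha
      · exact Or.inr ⟨Nat.pos_of_ne_zero fun h0' => ha ((ZMod.val_eq_zero a).1 h0'), h⟩
    · rintro (rfl | ⟨-, h⟩)
      · rw [ZMod.val_zero]; exact Nat.zero_le n
      · exact h
  have h := sum_filter_val_le_ne_zero_of_odd hpn hχ
  rwa [hfilter, Finset.sum_insert h0, MulChar.map_zero, zero_add] at h

end Leopoldt

/-! ## §2 Kubota's Theorem 2 on the group `(ℤ/p)ˣ`: the type `{u : 1 ≤ ⟨u⟩ ≤ n}` has rank `n + 1` -/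

section Units

variable {p n : ℕ} [hp : Fact p.Prime]

/-- The set `{u ∈ (ℤ/p)ˣ : ⟨u⟩ ∈ {1, …, n}}` is a CM type for the conjugation `ρ = −1` of the group `(ℤ/p)ˣ`
acting on itself ("there are no two automorphisms among `φᵢ` which are complex conjugate of each other").
[cite: Shimura1998, §8.4 Example (1)] [cite: Kubota1965, §4 Theorem 2] -/
theorem isCMTypeWith_units (hpn : p = 2 * n + 1) :
    IsCMTypeWith (-1 : (ZMod p)ˣ)
      (↑(Finset.univ.filter fun u : (ZMod p)ˣ => (u : ZMod p) ∈ halfResidues p n) : Set (ZMod p)ˣ) where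
  mem_iff u := by
    haveI : NeZero p := ⟨hp.out.ne_zero⟩
    simp only [Finset.coe_filter, Finset.mem_univ, true_and, Set.mem_setOf_eq, smul_eq_mul, Units.val_neg,
      neg_mul, one_mul]
    exact mem_halfResidues_iff_neg_notMem hpn (u : ZMod p) u.ne_zero
  comm g u := by
    simp only [smul_eq_mul]
    rw [mul_left_comm]
  invol u := by
    simp only [smul_eq_mul, neg_mul, one_mul, neg_neg]

/-- `|(ℤ/p)ˣ| = 2n` for `p = 2n + 1` prime. [folklore] -/
private theorem card_units_eq (hpn : p = 2 * n + 1) : Fintype.card (ZMod p)ˣ = 2 * n := by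
  rw [ZMod.card_units p]
  omega

/-- **Kubota 1965, Theorem 2 (group level).**  For the prime `p = 2n + 1`, the rank of the type
`{u : 1 ≤ ⟨u⟩ ≤ n} ⊂ (ℤ/p)ˣ` (translates under `(ℤ/p)ˣ`) is `n + 1`, i.e. the type is NONDEGENERATE: by Kubota's
Lemma 2 (`rank = 1 + #{χ odd : Σ_{s∈Φ} χ(s) ≠ 0}`, the tree's `typeRank_eq_iff_forall_oddCharacters`) it suffices
that no odd character `χ` of `(ℤ/p)ˣ` has `Σ_{1 ≤ ⟨u⟩ ≤ n} χ(u) = 0`, which is Lemma 3 ("it follows immediately from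
Lemma 2 and Lemma 3 that `(F; {σᵢ})` is nondegenerate"). [cite: Kubota1965, §4 Theorem 2]
[cite: Gordon1999HodgeAVSurvey, §9.4.2] -/
theorem typeRank_units_eq (hpn : p = 2 * n + 1) :
    typeRank (ZMod p)ˣ
        (↑(Finset.univ.filter fun u : (ZMod p)ˣ => (u : ZMod p) ∈ halfResidues p n) : Set (ZMod p)ˣ) =
      n + 1 := by
  classical
  haveI : NeZero p := ⟨hp.out.ne_zero⟩
  have hnp : n < p := by omega
  have h := isCMTypeWith_units (p := p) (n := n) hpn
  have key := h.typeRank_eq_iff_forall_oddCharacters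
  rw [card_units_eq hpn, Nat.mul_div_cancel_left n (by norm_num : 0 < 2)] at key
  refine key.2 fun χ hχodd => ?_
  -- the character `χ : (ℤ/p)ˣ → ℂˣ` as a Dirichlet character modulo `p`
  let ψ₀ : (ZMod p)ˣ →* ℂ :=
    { toFun := fun u => χ (Additive.ofMul u)
      map_one' := by simp only [ofMul_one, AddChar.map_zero_eq_one]
      map_mul' := fun a b => by simp only [ofMul_mul, AddChar.map_add_eq_mul] }
  let χ' : DirichletCharacter ℂ p := MulChar.ofUnitHom ψ₀.toHomUnits
  have hχ' : ∀ u : (ZMod p)ˣ, χ' (u : ZMod p) = χ (Additive.ofMul u) := fun u => by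
    show MulChar.ofUnitHom ψ₀.toHomUnits (u : ZMod p) = _
    rw [MulChar.ofUnitHom_coe, MonoidHom.coe_toHomUnits]
    rfl
  have hodd' : χ'.Odd := by
    show χ' (-1) = -1
    rw [show (-1 : ZMod p) = ((-1 : (ZMod p)ˣ) : ZMod p) by simp, hχ']
    exact hχodd
  -- the character sum over the type is `Σ_{a ∈ {1,…,n}} χ'(a)`
  have hsum : ∑ s ∈ Finset.univ.filter (fun u : (ZMod p)ˣ => (u : ZMod p) ∈ halfResidues p n),
      χ (Additive.ofMul s) = ∑ a ∈ halfResidues p n, χ' a := by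
    refine Finset.sum_bij (fun u _ => (u : ZMod p)) (fun u hu => (Finset.mem_filter.1 hu).2)
      (fun u₁ _ u₂ _ h => Units.ext h) (fun b hb => ?_) (fun u _ => (hχ' u).symm)
    have hb0 : b ≠ 0 := by
      rintro rfl
      rw [mem_halfResidues_iff hnp, ZMod.val_zero] at hb
      omega
    exact ⟨Units.mk0 b hb0, Finset.mem_filter.2 ⟨Finset.mem_univ _, by simpa using hb⟩, Units.val_mk0 hb0⟩
  rw [hsum]
  exact sum_halfResidues_ne_zero_of_odd hpn hodd'

end Units

/-! ## §3 Kubota's Theorem 2 for the CM type `(ℚ(ζ_p); {φ₁, …, φₙ})` of the tree -/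

section Field

variable (p : ℕ) [hp : Fact p.Prime] (L : Type) [Field L] [NumberField L] [IsCyclotomicExtension {p} ℚ L]

/-- `e(τ • σ) = u(τ) · e(σ)`: `Aut(ℂ)` acts on the exponents of the embeddings of `ℚ(ζ_p)` through the cyclotomic
character (the tree's `expOf_comp` in the `•`-notation). [cite: Shimura1998, §8.4 Example (1)] -/
private theorem expOf_smul' [NeZero p] (τ : ℂ ≃+* ℂ) (σ : L →+* ℂ) :
    expOf p L (τ • σ) = autExp p τ * expOf p L σ := by
  rw [ringEquiv_smul_def, RingEquiv.toRingHom_eq_coe, expOf_comp]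

/-- **The rank of `(ℚ(ζ_p); {φᵢ})` is the rank of `{1, …, n}` under `(ℤ/p)ˣ`.**  The exponent map
`σ ↦ e(σ)` is a bijection `Hom(ℚ(ζ_p), ℂ) ≃ (ℤ/p)ˣ` ("the automorphisms of `ℚ(ζ)` are given by `ζ → ζ^a`") under
which the `Aut(ℂ)`-translates of the type are the `(ℤ/p)ˣ`-translates of `{1, …, n}` ("`{γφ₁, …, γφₙ}`" ↔
"`{1·a, …, n·a mod (p)}`"), so the two spans of translates have the same dimension.
[cite: Shimura1998, §8.4 Example (1)] [cite: Kubota1965, §2 (p. 115)] -/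
theorem cmTypeRank_cmType_eq_typeRank_units (hp2 : p ≠ 2) :
    cmTypeRank (cmType p L hp2) =
      typeRank (ZMod p)ˣ
        (↑(Finset.univ.filter fun u : (ZMod p)ˣ => (u : ZMod p) ∈ halfResidues p (p / 2)) : Set (ZMod p)ˣ) := by
  classical
  haveI : NeZero p := ⟨hp.out.ne_zero⟩
  have hnp : p / 2 < p := Nat.div_lt_self hp.out.pos one_lt_two
  have hcop : ∀ u : (ZMod p)ˣ, (u : ZMod p).val.Coprime p := fun u => ZMod.val_coe_unit_coprime u
  -- the bijection `(ℤ/p)ˣ ≃ Hom(L, ℂ)`, `u ↦ σ_u` with `e(σ_u) = u`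
  choose e he using fun u : (ZMod p)ˣ => exists_expOf_eq p L (u : ZMod p) (hcop u)
  have hinj : Function.Injective e := fun u v h => Units.ext (by rw [← he u, ← he v, h])
  have hsurj : Function.Surjective e := fun σ => by
    refine ⟨ZMod.unitOfCoprime (expOf p L σ).val (coprime_expOf p L σ), expOf_injective p L ?_⟩
    rw [he, ZMod.coe_unitOfCoprime, ZMod.natCast_zmod_val]
  let E : (ZMod p)ˣ ≃ (L →+* ℂ) := Equiv.ofBijective e ⟨hinj, hsurj⟩
  have hE : ∀ u, E u = e u := fun u => rfl
  -- membership in the type and in its translates, read on exponents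
  have hmem : ∀ σ : L →+* ℂ, σ ∈ (cmType p L hp2).1 ↔ expOf p L σ ∈ halfResidues p (p / 2) := fun σ => by
    rw [mem_cmType_iff, mem_halfResidues_iff hnp]
  have hpre : E ⁻¹' (cmType p L hp2).1 =
      ↑(Finset.univ.filter fun u : (ZMod p)ˣ => (u : ZMod p) ∈ halfResidues p (p / 2)) := by
    ext u
    rw [Set.mem_preimage, hE, hmem, he, Finset.coe_filter]
    simp only [Finset.mem_univ, true_and, Set.mem_setOf_eq]
  have hstep : ∀ (τ : ℂ ≃+* ℂ) (g u : (ZMod p)ˣ), autExp p τ = (g : ZMod p) →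
      (τ • E u ∈ (cmType p L hp2).1 ↔ g • u ∈ E ⁻¹' (cmType p L hp2).1) := by
    intro τ g u hτ
    rw [Set.mem_preimage, hE, hE, smul_eq_mul, hmem, hmem, expOf_smul', he, he, hτ, Units.val_mul]
  rw [cmTypeRank, ← hpre]
  refine typeRank_eq_of_equiv E (cmType p L hp2).1 (fun τ => ?_) (fun g => ?_)
  · refine ⟨ZMod.unitOfCoprime (autExp p τ).val (coprime_autExp p τ), fun u => hstep τ _ u ?_⟩
    rw [ZMod.coe_unitOfCoprime, ZMod.natCast_zmod_val]
  · obtain ⟨τ, hτ⟩ := exists_autExp_eq p (g : ZMod p) (hcop g)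
    exact ⟨τ, fun u => hstep τ g u hτ⟩

/-- **Kubota 1965, Theorem 2 / Gordon 9.4.2 "`S₁` is nondegenerate".**  For every odd prime `p`, Shimura's
primitive CM type `(ℚ(ζ_p); {φᵢ : ζ ↦ ζ^i, 1 ≤ i ≤ (p−1)/2})` (the tree's `cmType p L hp2`) is NONDEGENERATE:
`rank = (p−1)/2 + 1` ("it follows immediately from Lemma 2 and Lemma 3 that `(F; {σᵢ})` is nondegenerate").
[cite: Kubota1965, §4 Theorem 2] [cite: Gordon1999HodgeAVSurvey, §9.4.2] -/
theorem isNondegenerate_cmType (hp2 : p ≠ 2) : IsNondegenerate (cmType p L hp2) := by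
  haveI : NeZero p := ⟨hp.out.ne_zero⟩
  have hodd : p % 2 = 1 := Nat.odd_iff.1 (hp.out.odd_of_ne_two hp2)
  have hpn : p = 2 * (p / 2) + 1 := by omega
  rw [isNondegenerate_iff, cmTypeRank_cmType_eq_typeRank_units p L hp2, typeRank_units_eq hpn,
    finrank_eq_totient p L, Nat.totient_prime hp.out]
  omega

/-- The rank of `(ℚ(ζ_p); {φᵢ})` is `(p−1)/2 + 1 = (p+1)/2` (Kubota: "`rank (F; {φᵢ}) ≦ m + 1`" with equality).
[cite: Kubota1965, §2 (2) and §4 Theorem 2] -/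
theorem cmTypeRank_cmType (hp2 : p ≠ 2) : cmTypeRank (cmType p L hp2) = p / 2 + 1 := by
  haveI : NeZero p := ⟨hp.out.ne_zero⟩
  have hodd : p % 2 = 1 := Nat.odd_iff.1 (hp.out.odd_of_ne_two hp2)
  have hpn : p = 2 * (p / 2) + 1 := by omega
  rw [cmTypeRank_cmType_eq_typeRank_units p L hp2, typeRank_units_eq hpn]

end Field

/-! ## §4 The abelian varieties of type `(ℚ(ζ_p); {φᵢ})`: `B = D` on all powers and the Hodge conjecture -/

section Hodge

open CategoryTheory CategoryTheory.Limits
open Literature.AlgebraicGeometry.Motives (AbelianVariety)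
open Literature.AlgebraicGeometry.HodgeTheory
open Literature.AlgebraicGeometry.VanGeemen1994 (hodgeClassSpan)
open Literature.Barriers.HodgeConjecture (divisorClassesSpan)

variable {p : ℕ} [hp : Fact p.Prime] {L : Type} [Field L] [NumberField L] [IsCyclotomicExtension {p} ℚ L]
  {hp2 : p ≠ 2} {A : AbelianVariety ℂ} {ι : 𝓞 L →+* End A} {θ : L →+* Module.End ℂ (complexBetti A.X 1)}

/-- `ℚ(ζ_p)` is a CM field for an odd prime `p` (Mathlib). [folklore] -/
private theorem isCMField_of_ne_two (hp2 : p ≠ 2) : IsCMField L :=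
  IsCyclotomicExtension.Rat.isCMField L (S := {p})
    ⟨p, rfl, lt_of_le_of_ne hp.out.two_le (Ne.symm hp2)⟩

/-- **`Bᵐ(Aᵏ) ⊗ ℂ = Dᵐ(Aᵏ) ⊗ ℂ` for every power of every abelian variety of type `(ℚ(ζ_p); {φᵢ})`** (White /
Hazama: nondegenerate ⟹ `Hdg(Aᵏ) = Div(Aᵏ)` for all `k`), e.g. for the Jacobian of `y² = 1 − x^p`.
[cite: Kubota1965, §4 Theorem 2] [cite: Gordon1999HodgeAVSurvey, Thm. 6.4 and §9.3] -/
theorem hodgeClassSpan_pow_eq_divisorClassesSpan (hA : IsCMTypeRealisation (cmType p L hp2) A ι θ) (k m : ℕ) :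
    hodgeClassSpan (⨁ fun _ : Fin k => A).dim (⨁ fun _ : Fin k => A).X m =
      divisorClassesSpan (⨁ fun _ : Fin k => A).X (⨁ fun _ : Fin k => A).dim m := by
  haveI := isCMField_of_ne_two (L := L) hp2
  exact (isNondegenerate_cmType p L hp2).hodgeClassSpan_pow_eq_divisorClassesSpan hA k m

/-- **The Hodge conjecture for every power `Aᵏ` of every abelian variety of CM type `(ℚ(ζ_p); {φᵢ})`**, `p` any
odd prime — in particular for all powers of the Jacobian of `y² = 1 − x^p` (Kubota's Theorem 2 with Hazama's
theorem), UNCONDITIONALLY. [cite: Kubota1965, §4 Theorem 2] [cite: Gordon1999HodgeAVSurvey, Thm. 6.4 and §9.3] -/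
theorem hodgeConjectureFor_pow (hA : IsCMTypeRealisation (cmType p L hp2) A ι θ) (k : ℕ) :
    HodgeConjectureFor (⨁ fun _ : Fin k => A).dim (⨁ fun _ : Fin k => A).X := by
  haveI := isCMField_of_ne_two (L := L) hp2
  exact (isNondegenerate_cmType p L hp2).hodgeConjectureFor_pow hA k

/-- **The Hodge conjecture for every abelian variety of CM type `(ℚ(ζ_p); {φᵢ})`** (a simple abelian variety of
dimension `(p−1)/2`, `isSimple_of_isCMTypeRealisation`), in the spelling `HodgeConjectureFor A.dim A.X`.
[cite: Kubota1965, §4 Theorem 2] [cite: Gordon1999HodgeAVSurvey, Thm. 6.4 and §9.3] -/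
theorem hodgeConjectureFor (hA : IsCMTypeRealisation (cmType p L hp2) A ι θ) : HodgeConjectureFor A.dim A.X := by
  haveI := isCMField_of_ne_two (L := L) hp2
  exact (isNondegenerate_cmType p L hp2).hodgeConjectureFor hA

/-- **Non-vacuity**: for every odd prime `p` there is a SIMPLE abelian variety of dimension `(p−1)/2` with complex
multiplication by `ℚ(ζ_p)` of type `{φ₁, …, φₙ}` (realisations exist, Shimura §6.2 Thm. 3 = tree
`exists_isCMTypeRealisation`), all of whose powers satisfy the Hodge conjecture.
[cite: Shimura1998, §6.2 Thm. 3] [cite: Kubota1965, §4 Theorem 2] [cite: Gordon1999HodgeAVSurvey, Thm. 6.4 and §9.3] -/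
theorem exists_isSimple_hodgeConjectureFor_pow (hp2 : p ≠ 2) :
    ∃ (B : AbelianVariety ℂ) (ι' : 𝓞 L →+* End B) (θ' : L →+* Module.End ℂ (complexBetti B.X 1)),
      IsCMTypeRealisation (cmType p L hp2) B ι' θ' ∧ B.IsSimple ∧ B.dim = (p - 1) / 2 ∧
        ∀ k : ℕ, HodgeConjectureFor (⨁ fun _ : Fin k => B).dim (⨁ fun _ : Fin k => B).X := by
  haveI := isCMField_of_ne_two (L := L) hp2
  obtain ⟨B, ι', θ', hB⟩ := exists_isCMTypeRealisation (cmType p L hp2)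
  exact ⟨B, ι', θ', hB, isSimple_of_isCMTypeRealisation hB, dim_eq_of_isCMTypeRealisation hB,
    fun k => hodgeConjectureFor_pow hB k⟩

end Hodge

end ShimuraCyclotomicCMType

end Literature.AlgebraicGeometry.ComplexMultiplication

end
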